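import Summits.HodgeConjecture.CorCM.Census.CentralSquaresPairFaceCover
import Summits.HodgeConjecture.CorCM.Census.CentralSquaresDihedralFibre

/-!
# The square-central class, XXII: THE `m = 2` DIHEDRAL LAW — `μ(G, c) = φ₂(G, c)` for the degree-16 groups mapping onto `D₄` with `c ↦ r²` and `s` lifting to an involution

COR-CM (cell `pub-hodgecm2`), count-neutral kernel combinatorics by the binder seat b09 (gen 46; lane SQUARE-CENTRAL CLASS, part XXII), instantiating part XXIʼs
`m = 2` frame law (`isLeast_card_gfaces_generate_two_swaps`) along a surjection `π : G ↠ D₄` with kernel of order `2`; the eight-element facts about `D₄` are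
parts IX/XIʼs (`dihedral_*`, `dihedral_stab_sr`) plus two more `decide`s on `DihedralGroup 4` (`dihedral_sigma_sr0`, `dihedral_commutator`); the fibre count is
part Xʼs `card_filter_comap`.  Theorems only: no definition, no certificate, no named fact, no `sorry`.  HONEST FRAMING: `HC_CM` is NOT proved, here or anywhere
in the tree; nothing here is a period or a headline.

**THE `m = 2` DIHEDRAL LAW (`isLeast_card_gfaces_generate_of_dihedral_quotient_two`).**  Let `G` be a finite group with a central involution `c` and
`π : G →* D₄` a SURJECTIVE homomorphism with `π c = r²` and `|ker π| = 2`, such that the reflection `s` lifts to an involution `q ∈ G`.  Then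
**`μ(G, c) = φ₂(G, c)`**: the least number of faces whose base changes together with the pairs generate the Hodge lattice equals the coinvariant fibre.
This closes the two dihedral-quotient rows of order `16` left open by part X (`|ker π| ≥ 4` there): `D₄ × ℤ/2` with `c = (r², ·)` (`β = 26`, `μ = φ₂ = 24`)
and `G(16,3) = ⟨a, b, x | a⁴ = b² = x² = 1, ab = ba, bx = xb, xax = ab⟩` with `c = [a, x] = b` (`β = 24`, `μ = φ₂ = 22`); `ℤ/4 ⋊ ℤ/4` (no involution over
`s`) stays open.  With part XIʼs `fibreTwo_add_two_eq_card_block_of_dihedral_quotient'` the value is `β(G,c) − 2`.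

THE DATUM (kernel `{1, z}`, `ρ` over `r`, `g₁` over `sr`): `T₀ = π⁻¹{1, r, s, sr}`, swaps `q` and `zq` (place involutions differ everywhere since `z ∉ {1, c}`),
`T₁ = T₀·q⁻¹`, `𝓗 = π⁻¹{r, sr}`, `T = π⁻¹(r) = {ρ, ρz}`, `a = 1`, `a' = q`, the designated type `Φ` with `D(Φ) = {ρ, ρz, 1, q}`; its translate `Φ·g₁⁻¹` has
`D = {ρg₁⁻¹, ρzg₁⁻¹} ∪ {g₁⁻¹, qg₁⁻¹}` = `π⁻¹(s) ∪` a swapped pair of `𝓗` — for `q` if `[q, g₁] = c`, for `zq` if `[q, g₁] = cz` — and `g₁` carries the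
designated face to the companion face.

## References
* [Pohlmann1968] H. Pohlmann, Algebraic cycles on abelian varieties of complex multiplication type, Ann. of Math. 88 (1968), Thm 1.
* [Milne1999] J. S. Milne, Lefschetz motives and the Tate conjecture, Compositio Math. 117 (1999), Prop. 2.1, p. 54.
-/

namespace Summit.HodgeConjecture.CorCM.Census.CentralSquares

open Finset DihedralGroup
open Summit.HodgeConjecture.CorCM.Prior.AllgGroup.RfwfAllgGroup
open Summit.HodgeConjecture.CorCM.Census.BlockParity
open Summit.HodgeConjecture.CorCM.Census.Coinvariant
open Summit.HodgeConjecture.CorCM.Census.TwistGeneration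
open Summit.HodgeConjecture.CorCM.Census.BaseBlock

noncomputable section

variable {G : Type*} [Group G] [Fintype G] [DecidableEq G]

/-! ## §1 Two more facts about `D₄` -/

/-- On `{1, s}` the place permutation of the swap exchanges `1 ↔ s`: `x = s ↔ y ≠ s`. [folklore] -/
theorem dihedral_sigma_sr0 : ∀ x y : DihedralGroup 4, x ∈ ({r 0, sr 0} : Finset (DihedralGroup 4)) →
    y ∈ ({r 0, sr 0} : Finset (DihedralGroup 4)) → (y = x * sr 0 ∨ y = r 2 * (x * sr 0)) → (x = sr 0 ↔ y ≠ sr 0) := by decide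

/-- `[s, sr] = r²`, in the form `s · (sr)⁻¹ · s⁻¹ · sr = r²`; and the products `r · sr = s`, `s · sr = r`, `(sr)⁻¹ = sr`. [folklore] -/
theorem dihedral_commutator : (sr 0 : DihedralGroup 4) * (sr 1)⁻¹ * (sr 0)⁻¹ * sr 1 = r 2 ∧ (r 1 : DihedralGroup 4) * (sr 1)⁻¹ = sr 0 ∧
    (sr 0 : DihedralGroup 4) * (sr 1)⁻¹ = r 1 ∧ ((sr 1)⁻¹ : DihedralGroup 4) = sr 1 := by decide

/-! ## §2 The kernel involution -/

omit [Fintype G] [DecidableEq G] in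
/-- **A kernel of order `2` is `{1, z}` for a central involution `z`.** [folklore] -/
theorem exists_ker_involution (π : G →* DihedralGroup 4) (hker : Nat.card π.ker = 2) :
    ∃ z : G, z ≠ 1 ∧ π z = 1 ∧ z * z = 1 ∧ (∀ x : G, x * z = z * x) ∧ ∀ g : G, π g = 1 → g = 1 ∨ g = z := by
  rw [Nat.card_eq_two_iff' (1 : π.ker)] at hker
  obtain ⟨y, hy1, huniq⟩ := hker
  have hz1 : (y : G) ≠ 1 := fun h => hy1 (Subtype.ext h)
  have hπz : π y = 1 := y.2
  have hcases : ∀ g : G, π g = 1 → g = 1 ∨ g = y := by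
    intro g hg
    by_cases h1 : g = 1
    · exact Or.inl h1
    · right
      have h := huniq ⟨g, hg⟩ (fun h => h1 (congrArg Subtype.val h))
      exact (congrArg Subtype.val h :)
  refine ⟨y, hz1, hπz, ?_, fun x => ?_, hcases⟩
  · rcases hcases (y * y) (by rw [map_mul, hπz, mul_one]) with h | h
    · exact h
    · exact absurd (mul_left_cancel (h.trans (mul_one _).symm)) hz1
  · rcases hcases (x * y * x⁻¹) (by rw [map_mul, map_mul, hπz, mul_one, ← map_mul, mul_inv_cancel, map_one]) with h | h
    · exfalso; apply hz1
      have h' : x * y = x := by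
        calc x * (y : G) = x * y * x⁻¹ * x := by group
          _ = x := by rw [h, one_mul]
      exact mul_left_cancel (h'.trans (mul_one x).symm)
    · calc x * (y : G) = x * y * x⁻¹ * x := by group
        _ = y * x := by rw [h]

/-! ## §3 The law -/

/-- **THE `m = 2` DIHEDRAL LAW.**  `G` a finite group, `c` a central involution, `π : G →* D₄` surjective with `π c = r²` and `|ker π| = 2`, and an involution
`q ∈ G` over the reflection `s`: **`μ(G, c) = φ₂(G, c)`**. [folklore] -/
theorem isLeast_card_gfaces_generate_of_dihedral_quotient_two {c : G} (hc2 : c * c = 1) (hcen : ∀ x : G, x * c = c * x)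
    (π : G →* DihedralGroup 4) (hπ : Function.Surjective π) (hπc : π c = r 2) (hker : Nat.card π.ker = 2)
    (q : G) (hπq : π q = sr 0) (hqq : q * q = 1) :
    IsLeast {n : ℕ | ∃ S : Finset (CMF G c →₀ ℤ), (↑S ⊆ gfaceSet G c hc2) ∧ S.card = n ∧
      hodgeSpan c hc2 ≤ Submodule.span ℤ (pairSet c) ⊔ Submodule.span ℤ (translates c S)} (fibreTwo c hc2) := by
  classical
  have hc1 : c ≠ 1 := by
    intro h; rw [h, map_one] at hπc; exact absurd hπc (by decide)
  -- the `2`-group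
  have hG : IsPGroup 2 G := by
    refine IsPGroup.of_card (n := 4) ?_
    have h := card_filter_comap π hπ (univ : Finset (DihedralGroup 4))
    rw [filter_true_of_mem (fun g _ => mem_univ (π g)), card_univ, card_univ, hker] at h
    rw [Nat.card_eq_fintype_card, h]; rfl
  -- the kernel involution and the second swap
  obtain ⟨z, hz1, hπz, hz2, hzc, hkz⟩ := exists_ker_involution π hker
  have hzc' : z ≠ c := by intro h; rw [h, hπc] at hπz; exact absurd hπz (by decide)
  obtain ⟨hcomm, hrsr, hssr, hsrinv⟩ := dihedral_commutator
  -- the datum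
  set X₀ : Finset (DihedralGroup 4) := {r 0, r 1, sr 0, sr 1} with hX₀
  let T₀ : CMF G c := ⟨univ.filter fun g : G => π g ∈ X₀, isCMF_comap π hπc⟩
  let T₁ : CMF G c := rt c q T₀
  have hT₀mem : ∀ P : G, P ∈ T₀.1 ↔ π P ∈ X₀ := fun P => by
    change P ∈ univ.filter (fun g : G => π g ∈ X₀) ↔ _; rw [mem_filter]; simp only [mem_univ, true_and]
  have hrtmem : ∀ (R P : G), P ∈ (rt c R T₀).1 ↔ π P * π R ∈ X₀ := fun R P => by rw [mem_rt, hT₀mem, map_mul]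
  have hT₁mem : ∀ P : G, P ∈ T₁.1 ↔ π P * sr 0 ∈ X₀ := fun P => by
    change P ∈ (rt c q T₀).1 ↔ _; rw [hrtmem, hπq]
  have hHset : T₀.1 \ T₁.1 = univ.filter fun g : G => π g ∈ ({r 1, sr 1} : Finset (DihedralGroup 4)) := by
    ext P; rw [mem_sdiff, hT₀mem, hT₁mem, mem_filter]; simp only [mem_univ, true_and]; exact dihedral_H (π P)
  have hHcset : T₀.1 ∩ T₁.1 = univ.filter fun g : G => π g ∈ ({r 0, sr 0} : Finset (DihedralGroup 4)) := by
    ext P; rw [mem_inter, hT₀mem, hT₁mem, mem_filter]; simp only [mem_univ, true_and]; exact dihedral_Hc (π P)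
  have hHmem : ∀ P : G, P ∈ T₀.1 \ T₁.1 ↔ π P ∈ ({r 1, sr 1} : Finset (DihedralGroup 4)) := fun P => by
    rw [hHset, mem_filter]; simp only [mem_univ, true_and]
  have hHcmem : ∀ P : G, P ∈ T₀.1 ∩ T₁.1 ↔ π P ∈ ({r 0, sr 0} : Finset (DihedralGroup 4)) := fun P => by
    rw [hHcset, mem_filter]; simp only [mem_univ, true_and]
  -- both swaps `q`, `zq` map to `s`
  have hzq : ∀ t : G, t * (z * q) = z * (t * q) := fun t => by rw [← mul_assoc, hzc t, mul_assoc]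
  have hplace : ∀ t t' : G, (t' = t * q ∨ t' = c * (t * q)) → (π t' = π t * sr 0 ∨ π t' = r 2 * (π t * sr 0)) := by
    intro t t' h
    rcases h with h | h
    · left; rw [h, map_mul, hπq]
    · right; rw [h, map_mul, map_mul, hπc, hπq]
  have hplace₂ : ∀ t t' : G, (t' = t * (z * q) ∨ t' = c * (t * (z * q))) → (π t' = π t * sr 0 ∨ π t' = r 2 * (π t * sr 0)) := by
    intro t t' h
    rcases h with h | h
    · left; rw [h, map_mul, map_mul, hπz, hπq, one_mul]
    · right; rw [h, map_mul, map_mul, map_mul, hπc, hπz, hπq, one_mul]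
  have hbase : ∀ R : G, rt c R T₀ = T₀ ∨ rt c R T₀ = rt c c T₀ ∨ rt c R T₀ = T₁ ∨ rt c R T₀ = rt c c T₁ := by
    intro R
    have hrr : ∀ P : G, P ∈ (rt c c T₀).1 ↔ π P * r 2 ∈ X₀ := fun P => by rw [hrtmem, hπc]
    have hrT₁ : ∀ P : G, P ∈ (rt c c T₁).1 ↔ π P * (r 2 * sr 0) ∈ X₀ := fun P => by
      change P ∈ (rt c c (rt c q T₀)).1 ↔ _; rw [← rt_mul, hrtmem, map_mul, hπc, hπq]
    rcases dihedral_base (π R) with h | h | h | h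
    · exact Or.inl (Subtype.ext (Finset.ext fun P => by rw [hrtmem, hT₀mem]; exact h (π P)))
    · exact Or.inr (Or.inl (Subtype.ext (Finset.ext fun P => by rw [hrtmem, hrr]; exact h (π P))))
    · exact Or.inr (Or.inr (Or.inl (Subtype.ext (Finset.ext fun P => by rw [hrtmem, hT₁mem]; exact h (π P)))))
    · exact Or.inr (Or.inr (Or.inr (Subtype.ext (Finset.ext fun P => by rw [hrtmem, hrT₁]; exact h (π P)))))
  have hn : T₀.1.card = 4 * 2 := by
    change (univ.filter fun g : G => π g ∈ X₀).card = 4 * 2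
    rw [card_filter_comap π hπ X₀, hker]; rfl
  have hH : (T₀.1 \ T₁.1).card = 2 * 2 := by rw [hHset, card_filter_comap π hπ, hker]; rfl
  have hσH : ∀ t ∈ T₀.1, ∀ t' ∈ T₀.1, (t' = t * q ∨ t' = c * (t * q)) → (t ∈ T₀.1 \ T₁.1 ↔ t' ∈ T₀.1 \ T₁.1) := by
    intro t ht t' ht' h
    rw [hT₀mem] at ht ht'
    rw [hHmem, hHmem]
    exact dihedral_sigma_H (π t) (π t') ht ht' (hplace t t' h)
  have hQ₂ : rt c (z * q) T₀ = T₁ := by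
    apply Subtype.ext; ext P; rw [hrtmem, hT₁mem, map_mul, hπz, one_mul, hπq]
  have hQQ₂ : z * q * (z * q) = 1 := by
    calc z * q * (z * q) = z * ((q * z) * q) := by group
      _ = z * ((z * q) * q) := by rw [hzc q]
      _ = (z * z) * (q * q) := by group
      _ = 1 := by rw [hz2, hqq, one_mul]
  have hσH₂ : ∀ t ∈ T₀.1, ∀ t' ∈ T₀.1, (t' = t * (z * q) ∨ t' = c * (t * (z * q))) → (t ∈ T₀.1 \ T₁.1 ↔ t' ∈ T₀.1 \ T₁.1) := by
    intro t ht t' ht' h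
    rw [hT₀mem] at ht ht'
    rw [hHmem, hHmem]
    exact dihedral_sigma_H (π t) (π t') ht ht' (hplace₂ t t' h)
  have hne : ∀ t ∈ T₀.1, ∀ t' ∈ T₀.1, ∀ t'' ∈ T₀.1, (t' = t * q ∨ t' = c * (t * q)) →
      (t'' = t * (z * q) ∨ t'' = c * (t * (z * q))) → t' ≠ t'' := by
    rintro t - t' - t'' - h1 h2 rfl
    rw [hzq] at h2
    rcases h1 with e1 | e1 <;> rcases h2 with e2 | e2
    · have e : t * q = z * (t * q) := e1.symm.trans e2
      exact hz1 (right_eq_mul.mp e)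
    · have e : t * q = (c * z) * (t * q) := by rw [mul_assoc]; exact e1.symm.trans e2
      have hcz : c * z = 1 := (right_eq_mul.mp e)
      exact hzc' (mul_left_cancel (hcz.trans hc2.symm))
    · have e : c * (t * q) = z * (t * q) := e1.symm.trans e2
      exact hzc' (mul_right_cancel e).symm
    · have e : t * q = z * (t * q) := mul_left_cancel (e1.symm.trans e2)
      exact hz1 (right_eq_mul.mp e)
  -- the `σ`-transversal `T = π⁻¹(r) = {ρ, ρz}` and the designated type
  obtain ⟨ρ, hρ⟩ := hπ (r 1)
  have hρz : ρ ≠ ρ * z := fun h => hz1 (left_eq_mul.mp h)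
  have hTiff : ∀ v : G, v ∈ ({ρ, ρ * z} : Finset G) ↔ π v = r 1 := by
    intro v; rw [mem_insert, mem_singleton]
    constructor
    · rintro (rfl | rfl)
      · exact hρ
      · rw [map_mul, hρ, hπz, mul_one]
    · intro hv
      rcases hkz (ρ⁻¹ * v) (by rw [map_mul, map_inv, hρ, hv, inv_mul_cancel]) with h | h
      · left; rw [← mul_inv_cancel_left ρ v, h, mul_one]  -- hmm
      · right; rw [← mul_inv_cancel_left ρ v, h]
  have hTH : ({ρ, ρ * z} : Finset G) ⊆ T₀.1 \ T₁.1 := by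
    intro v hv; rw [hHmem, (hTiff v).mp hv]; decide
  have hT : ∀ t ∈ T₀.1 \ T₁.1, ∀ t' ∈ T₀.1, (t' = t * q ∨ t' = c * (t * q)) → (t ∈ ({ρ, ρ * z} : Finset G) ↔ t' ∉ ({ρ, ρ * z} : Finset G)) := by
    intro t ht t' ht' h
    rw [hHmem] at ht
    rw [hT₀mem] at ht'
    have htX : π t ∈ X₀ := dihedral_sub.1 (π t) ht
    obtain ⟨h2, h3, -, -⟩ := dihedral_sigma_val (π t) (π t') htX ht' (hplace t t' h)
    rw [hTiff, hTiff]
    have ht2 : π t = r 1 ∨ π t = sr 1 := by rwa [mem_insert, mem_singleton] at ht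
    constructor
    · intro e; rw [h2.mp e]; decide
    · intro hne'
      rcases ht2 with e | e
      · exact e
      · exact absurd (h3.mp e) hne'
  have ha : (1 : G) ∈ T₀.1 ∩ T₁.1 := by rw [hHcmem, map_one]; decide
  have ha' : q ∈ T₀.1 := by rw [hT₀mem, hπq]; decide
  have haa' : q = 1 * q ∨ q = c * (1 * q) := Or.inl (one_mul q).symm
  have hDsub : ({ρ, ρ * z} : Finset G) ∪ {1, q} ⊆ T₀.1 :=
    union_subset (hTH.trans sdiff_subset) (by
      intro x hx; rw [mem_insert, mem_singleton] at hx; rcases hx with rfl | rfl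
      · exact (mem_inter.mp ha).1
      · exact ha')
  obtain ⟨Φ, hΦ⟩ := exists_type_of_dev c hc2 T₀ _ hDsub
  -- the lift of `sr` and the companion type
  obtain ⟨g₁, hg₁⟩ := hπ (sr 1)
  have hg₁T₀ : rt c g₁ T₀ = T₀ := by
    apply Subtype.ext; ext P; rw [hrtmem, hT₀mem, hg₁]; exact dihedral_stab_sr (π P)
  have huu' : ρ * g₁⁻¹ ≠ ρ * z * g₁⁻¹ := fun h => hρz (mul_right_cancel h)
  have hπu : π (ρ * g₁⁻¹) = sr 0 := by rw [map_mul, map_inv, hρ, hg₁, hrsr]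
  have hπu' : π (ρ * z * g₁⁻¹) = sr 0 := by rw [map_mul, map_mul, map_inv, hρ, hπz, hg₁, mul_one, hrsr]
  have hT'iff : ∀ v : G, v ∈ ({ρ * g₁⁻¹, ρ * z * g₁⁻¹} : Finset G) ↔ π v = sr 0 := by
    intro v; rw [mem_insert, mem_singleton]
    constructor
    · rintro (rfl | rfl)
      · exact hπu
      · exact hπu'
    · intro hv
      rcases hkz ((ρ * g₁⁻¹)⁻¹ * v) (by rw [map_mul, map_inv, hπu, hv, inv_mul_cancel]) with h | h
      · left; rw [← mul_inv_cancel_left (ρ * g₁⁻¹) v, h, mul_one]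
      · right; rw [← mul_inv_cancel_left (ρ * g₁⁻¹) v, h, mul_assoc ρ g₁⁻¹ z, hzc g₁⁻¹, ← mul_assoc]
  have hTH' : ({ρ * g₁⁻¹, ρ * z * g₁⁻¹} : Finset G) ⊆ T₀.1 ∩ T₁.1 := by
    intro v hv; rw [hHcmem, (hT'iff v).mp hv]; decide
  have hT'tr : ∀ (R : G), (∀ t t' : G, (t' = t * R ∨ t' = c * (t * R)) → (π t' = π t * sr 0 ∨ π t' = r 2 * (π t * sr 0))) →
      ∀ v ∈ T₀.1 ∩ T₁.1, ∀ v' ∈ T₀.1, (v' = v * R ∨ v' = c * (v * R)) →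
        (v ∈ ({ρ * g₁⁻¹, ρ * z * g₁⁻¹} : Finset G) ↔ v' ∉ ({ρ * g₁⁻¹, ρ * z * g₁⁻¹} : Finset G)) := by
    intro R hR v hv v' hv' h
    rw [hHcmem] at hv
    have hv'c : π v' ∈ ({r 0, sr 0} : Finset (DihedralGroup 4)) := by
      rw [← hHcmem]
      have hvX : v ∈ T₀.1 := by rw [hT₀mem]; exact dihedral_sub.2 (π v) hv
      have hside := dihedral_sigma_H (π v) (π v') (dihedral_sub.2 (π v) hv) ((hT₀mem v').mp hv') (hR v v' h)
      rw [mem_inter]; refine ⟨hv', ?_⟩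
      by_contra hv'1
      have hv'H : v' ∈ T₀.1 \ T₁.1 := mem_sdiff.mpr ⟨hv', hv'1⟩
      rw [hHmem] at hv'H
      have hvH := hside.mpr hv'H
      have : v ∈ T₀.1 \ T₁.1 := by rw [hHmem]; exact hvH
      exact (mem_sdiff.mp this).2 ((hHcmem v).mpr hv |> fun h => (mem_inter.mp h).2)
    rw [hT'iff, hT'iff]
    exact dihedral_sigma_sr0 (π v) (π v') hv hv'c (hR v v' h)
  have hs : g₁⁻¹ ∈ T₀.1 \ T₁.1 := by rw [hHmem, map_inv, hg₁, hsrinv]; decide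
  have hs' : q * g₁⁻¹ ∈ T₀.1 := by rw [hT₀mem, map_mul, map_inv, hπq, hg₁, hssr]; decide
  have hΦc : T₀.1 \ (rt c g₁ Φ).1 = {ρ * g₁⁻¹, ρ * z * g₁⁻¹} ∪ {g₁⁻¹, q * g₁⁻¹} := by
    ext x
    rw [show T₀.1 \ (rt c g₁ Φ).1 = (rt c g₁ T₀).1 \ (rt c g₁ Φ).1 by rw [hg₁T₀], mem_sdiff_rt_iff, hΦ]
    simp only [mem_union, mem_insert, mem_singleton]
    rw [← eq_mul_inv_iff_mul_eq, ← eq_mul_inv_iff_mul_eq, ← eq_mul_inv_iff_mul_eq, ← eq_mul_inv_iff_mul_eq, one_mul]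
  -- `[q, g₁] ∈ {c, cz}` decides which swap the companion pair belongs to
  have hk : π (q * g₁⁻¹ * q⁻¹ * g₁ * c) = 1 := by
    rw [map_mul, map_mul, map_mul, map_mul, map_inv, map_inv, hπq, hg₁, hπc, hcomm]; decide
  have hcase : ((∀ v ∈ T₀.1 ∩ T₁.1, ∀ v' ∈ T₀.1, (v' = v * q ∨ v' = c * (v * q)) →
        (v ∈ ({ρ * g₁⁻¹, ρ * z * g₁⁻¹} : Finset G) ↔ v' ∉ ({ρ * g₁⁻¹, ρ * z * g₁⁻¹} : Finset G))) ∧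
        (q * g₁⁻¹ = g₁⁻¹ * q ∨ q * g₁⁻¹ = c * (g₁⁻¹ * q))) ∨
      ((∀ v ∈ T₀.1 ∩ T₁.1, ∀ v' ∈ T₀.1, (v' = v * (z * q) ∨ v' = c * (v * (z * q))) →
        (v ∈ ({ρ * g₁⁻¹, ρ * z * g₁⁻¹} : Finset G) ↔ v' ∉ ({ρ * g₁⁻¹, ρ * z * g₁⁻¹} : Finset G))) ∧
        (q * g₁⁻¹ = g₁⁻¹ * (z * q) ∨ q * g₁⁻¹ = c * (g₁⁻¹ * (z * q)))) := by
    -- `k := q g₁⁻¹ q⁻¹ g₁` satisfies `q g₁⁻¹ = k (g₁⁻¹ q)` and `k c ∈ ker π = {1, z}`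
    have hkq : q * g₁⁻¹ = (q * g₁⁻¹ * q⁻¹ * g₁) * (g₁⁻¹ * q) := by group
    rcases hkz _ hk with h | h
    · left
      refine ⟨hT'tr q hplace, Or.inr ?_⟩
      have hkc : q * g₁⁻¹ * q⁻¹ * g₁ = c := (eq_inv_of_mul_eq_one_left h).trans (inv_eq_of_mul_eq_one_right hc2)
      rw [hkq, hkc]
    · right
      refine ⟨hT'tr (z * q) hplace₂, Or.inr ?_⟩
      have hkc : q * g₁⁻¹ * q⁻¹ * g₁ = z * c := by
        have h' : q * g₁⁻¹ * q⁻¹ * g₁ * c * c = z * c := by rw [h]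
        rwa [mul_assoc, hc2, mul_one] at h'
      rw [hkq, hkc, hzq, ← mul_assoc c z (g₁⁻¹ * q), hzc c]
  -- the frame law
  refine isLeast_card_gfaces_generate_two_swaps c hc2 hcen T₀ T₁ hbase 2 hn hH hG hc1 rfl q rfl hqq hσH (z * q) hQ₂ hQQ₂ hσH₂ hne
    {ρ, ρ * z} hTH hT rfl hρz ha ha' haa' Φ hΦ {ρ * g₁⁻¹, ρ * z * g₁⁻¹} hTH' rfl huu' hs hs' hcase (rt c g₁ Φ) hΦc ?_
  intro L hL hF
  have h := hL g₁ _ hF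
  rwa [mapDomain_rt_gface] at h

end

end Summit.HodgeConjecture.CorCM.Census.CentralSquares
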